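import Mathlib.Analysis.Complex.Basic
import Mathlib.Algebra.Category.ModuleCat.Basic
import Summits.Ventures.HodgeRepro2.HostAPI.Carriers.AlgebraicGeometry.Motives.Varieties
import Summits.Ventures.HodgeRepro2.HostAPI.Carriers.AlgebraicGeometry.Motives.AlgPoints
import Summits.Ventures.HodgeRepro2.HostAPI.Carriers.AlgebraicGeometry.Motives.Cycles
import Summits.Ventures.HodgeRepro2.HostAPI.Carriers.AlgebraicGeometry.Motives.HodgeStructure
import Summits.Ventures.HodgeRepro2.HostAPI.Carriers.AlgebraicGeometry.Motives.PreWeilCohomology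
import Summits.Ventures.HodgeRepro2.HostAPI.Carriers.AlgebraicGeometry.Motives.WeilCohomology
import Summits.Ventures.HodgeRepro2.HostAPI.Carriers.AlgebraicTopology.SingularHomology.SingularCochains
import Summits.Ventures.HodgeRepro2.HostAPI.Carriers.AlgebraicTopology.SingularHomology.CupProduct
import Summits.Ventures.HodgeRepro2.HostAPI.Util.ForallBinderLint
open HostAPI.Carriers

universe u

open CategoryTheory AlgebraicGeometry Opposite

noncomputable section

namespace HostAPI.Carriers.AlgebraicGeometry.Motives

variable {k : Type} [Field k] [Algebra k ℂ]

abbrev bettiCohomology (X : SchemeOver k) (i : ℕ) : ModuleCat.{0} ℚ :=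
  HostAPI.Carriers.AlgebraicTopology.SingularHomology.singularCohomology ℚ ℚ (ComplexPoints X) i

namespace bettiCohomology

variable {X Y Z : SchemeOver k}

abbrev map (f : X ⟶ Y) (i : ℕ) : bettiCohomology Y i ⟶ bettiCohomology X i :=
  HostAPI.Carriers.AlgebraicTopology.SingularHomology.singularCohomology.map ℚ ℚ (AlgPoints.mapContinuous (L := ℂ) f) i

lemma _root_.HostAPI.Carriers.AlgebraicGeometry.Motives.AlgPoints.mapContinuous_id {L : Type u} [Field L] {k' : Type u} [Field k']
    [Algebra k' L] [TopologicalSpace L] (X : SchemeOver k') :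
    AlgPoints.mapContinuous (L := L) (𝟙 X) = ContinuousMap.id _ :=
  ContinuousMap.ext AlgPoints.map_id_apply

lemma _root_.HostAPI.Carriers.AlgebraicGeometry.Motives.AlgPoints.mapContinuous_comp {L : Type u} [Field L] {k' : Type u} [Field k']
    [Algebra k' L] [TopologicalSpace L] {X Y Z : SchemeOver k'} (φ : X ⟶ Y) (ψ : Y ⟶ Z) :
    AlgPoints.mapContinuous (L := L) (φ ≫ ψ) =
      (AlgPoints.mapContinuous ψ).comp (AlgPoints.mapContinuous φ) :=
  ContinuousMap.ext (AlgPoints.map_comp_apply φ ψ)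

@[simp]
lemma map_id (i : ℕ) : map (𝟙 X) i = 𝟙 _ := by
  rw [map, AlgPoints.mapContinuous_id, HostAPI.Carriers.AlgebraicTopology.SingularHomology.singularCohomology.map_id]

@[reassoc]
lemma map_comp (f : X ⟶ Y) (g : Y ⟶ Z) (i : ℕ) : map (f ≫ g) i = map g i ≫ map f i := by
  rw [map, AlgPoints.mapContinuous_comp, HostAPI.Carriers.AlgebraicTopology.SingularHomology.singularCohomology.map_comp]

end bettiCohomology

variable (k) in

def bettiFunctor (i : ℕ) : (SchemeOver k)ᵒᵖ ⥤ ModuleCat.{0} ℚ where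
  obj X := bettiCohomology X.unop i
  map f := bettiCohomology.map f.unop i
  map_id _ := bettiCohomology.map_id i
  map_comp f g := bettiCohomology.map_comp g.unop f.unop i

@[simp]
lemma bettiFunctor_obj (i : ℕ) (X : (SchemeOver k)ᵒᵖ) :
    (bettiFunctor k i).obj X = bettiCohomology X.unop i := rfl

@[simp]
lemma bettiFunctor_map (i : ℕ) {X Y : (SchemeOver k)ᵒᵖ} (f : X ⟶ Y) :
    (bettiFunctor k i).map f = bettiCohomology.map f.unop i := rfl

section Cup

variable {X Y : SchemeOver k} {p q n : ℕ}

abbrev bettiCup (h : p + q = n) :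
    bettiCohomology X p →ₗ[ℚ] bettiCohomology X q →ₗ[ℚ] bettiCohomology X n :=
  HostAPI.Carriers.AlgebraicTopology.SingularHomology.cupProduct h

variable (X) in

abbrev bettiOne : bettiCohomology X 0 :=
  HostAPI.Carriers.AlgebraicTopology.SingularHomology.singularCohomology.one ℚ (ComplexPoints X)

theorem bettiCup_map (f : X ⟶ Y) (h : p + q = n) (a : bettiCohomology Y p)
    (b : bettiCohomology Y q) :
    bettiCohomology.map f n (bettiCup h a b) =
      bettiCup h (bettiCohomology.map f p a) (bettiCohomology.map f q b) :=
  HostAPI.Carriers.AlgebraicTopology.SingularHomology.cupProduct_map _ h a b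

theorem bettiCup_gradedComm (hc : HostAPI.Carriers.AlgebraicTopology.SingularHomology.cupProduct_gradedComm ℚ (ComplexPoints X)) (h : p + q = n)
    (h' : q + p = n) (a : bettiCohomology X p) (b : bettiCohomology X q) :
    bettiCup h a b = ((-1 : ℚ) ^ (p * q)) • bettiCup h' b a :=
  hc h h' a b

theorem bettiCup_assoc {r m l s : ℕ} (hpq : p + q = m) (hqr : q + r = l) (hm : m + r = s)
    (hl : p + l = s) (a : bettiCohomology X p) (b : bettiCohomology X q)
    (c : bettiCohomology X r) :
    bettiCup hm (bettiCup hpq a b) c = bettiCup hl a (bettiCup hqr b c) :=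
  HostAPI.Carriers.AlgebraicTopology.SingularHomology.cupProduct_assoc hpq hqr hm hl a b c

theorem one_bettiCup (b : bettiCohomology X q) : bettiCup (Nat.zero_add q) (bettiOne X) b = b :=
  HostAPI.Carriers.AlgebraicTopology.SingularHomology.one_cupProduct b

theorem bettiCup_one (a : bettiCohomology X p) : bettiCup (Nat.add_zero p) a (bettiOne X) = a :=
  HostAPI.Carriers.AlgebraicTopology.SingularHomology.cupProduct_one a

theorem bettiCohomology.map_one (f : X ⟶ Y) : bettiCohomology.map f 0 (bettiOne Y) = bettiOne X :=
  HostAPI.Carriers.AlgebraicTopology.SingularHomology.singularCohomology.map_one _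

end Cup

section Coniveau

variable (X : SchemeOver k)

abbrev complexPointsCompl (Z : Set X.left) : Type :=
  {P : ComplexPoints X // P.pt ∉ Z}

abbrev bettiCohomology.restrictCompl (Z : Set X.left) (i : ℕ) :
    bettiCohomology X i ⟶ HostAPI.Carriers.AlgebraicTopology.SingularHomology.singularCohomology ℚ ℚ (complexPointsCompl X Z) i :=
  HostAPI.Carriers.AlgebraicTopology.SingularHomology.singularCohomology.map ℚ ℚ
    (⟨Subtype.val, continuous_subtype_val⟩ : C(complexPointsCompl X Z, ComplexPoints X)) i

def coniveau (i r : ℕ) : Submodule ℚ (bettiCohomology X i) :=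
  ⨆ (Z : Set X.left) (_ : IsClosed Z) (_ : ∀ z ∈ Z, (r : ℕ∞) ≤ Order.coheight z),
    LinearMap.ker (bettiCohomology.restrictCompl X Z i).hom

variable {X}

theorem isZero_singularCohomology_of_isEmpty (R : Type u) [CommRing R] (M : Type u)
    [AddCommGroup M] [Module R M] {E : Type u} [TopologicalSpace E] [IsEmpty E] (n : ℕ) :
    Limits.IsZero (HostAPI.Carriers.AlgebraicTopology.SingularHomology.singularCohomology R M E n) := by
  haveI : IsEmpty (HostAPI.Carriers.AlgebraicTopology.SingularHomology.SingularSimplex E n) :=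
    haveI : IsEmpty C(stdSimplex ℝ (Fin (n + 1)), E) :=
      ⟨fun f ↦ isEmptyElim (f (Classical.arbitrary _))⟩
    HostAPI.Carriers.AlgebraicTopology.SingularHomology.SingularSimplex.toContinuousMap.isEmpty
  haveI hs : Subsingleton ((HostAPI.Carriers.AlgebraicTopology.SingularHomology.singularCochainComplex R M E).X n) :=
    ⟨fun φ ψ ↦ HostAPI.Carriers.AlgebraicTopology.SingularHomology.singularCochainComplex.ext fun σ ↦ isEmptyElim σ⟩
  exact ShortComplex.isZero_homology_of_isZero_X₂ _
    (@ModuleCat.isZero_of_subsingleton _ _ ((HostAPI.Carriers.AlgebraicTopology.SingularHomology.singularCochainComplex R M E).X n) hs)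

theorem mem_coniveau_of_restrictCompl_eq_zero {i r : ℕ} {Z : Set X.left} (hZ : IsClosed Z)
    (hr : ∀ z ∈ Z, (r : ℕ∞) ≤ Order.coheight z) {x : bettiCohomology X i}
    (hx : bettiCohomology.restrictCompl X Z i x = 0) : x ∈ coniveau X i r := by
  refine Submodule.mem_iSup_of_mem Z (Submodule.mem_iSup_of_mem hZ
    (Submodule.mem_iSup_of_mem hr ?_))
  exact hx

variable (X) in

theorem coniveau_mono (i : ℕ) {r s : ℕ} (h : r ≤ s) : coniveau X i s ≤ coniveau X i r := by
  refine iSup_mono fun Z ↦ iSup_mono fun _ ↦ ?_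
  refine iSup_le fun hs ↦ le_iSup_of_le (fun z hz ↦ le_trans ?_ (hs z hz)) le_rfl
  exact_mod_cast h

variable (X) in

theorem antitone_coniveau (i : ℕ) : Antitone (coniveau X i) :=
  fun _ _ h ↦ coniveau_mono X i h

variable (X) in

theorem coniveau_zero (i : ℕ) : coniveau X i 0 = ⊤ := by
  refine eq_top_iff.2 fun x _ ↦ mem_coniveau_of_restrictCompl_eq_zero isClosed_univ
    (fun _ _ ↦ by simp) ?_
  haveI : IsEmpty (complexPointsCompl X Set.univ) := ⟨fun P ↦ P.2 (Set.mem_univ _)⟩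
  haveI := ModuleCat.subsingleton_of_isZero
    (isZero_singularCohomology_of_isEmpty ℚ ℚ (E := complexPointsCompl X Set.univ) i)
  exact Subsingleton.elim _ _

end Coniveau

structure BettiHodgeData (k : Type) [Field k] [Algebra k ℂ] where

  W : WeilCohomology k ℚ

  iso (i : ℕ) : W.H i ≅ bettiFunctor k i

  iso_cup : ∀ (X : SchemeOver k) ⦃p q n : ℕ⦄ (h : p + q = n) (a : W.obj X p) (b : W.obj X q),
    ((iso n).hom.app (op X)).hom (W.cup h a b) =
      bettiCup h (((iso p).hom.app (op X)).hom a) (((iso q).hom.app (op X)).hom b)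

  iso_one : ∀ X : SchemeOver k, ((iso 0).hom.app (op X)).hom (W.one X) = bettiOne X

  hodge : ∀ ⦃n : ℕ⦄ ⦃X : SchemeOver k⦄, IsSmoothProjective n X → ∀ i : ℕ,
    HodgeStructure (W.obj X i) (i : ℤ)

  pullback_hom : ∀ ⦃n : ℕ⦄ ⦃X : SchemeOver k⦄ (hX : IsSmoothProjective n X)
    ⦃m : ℕ⦄ ⦃Y : SchemeOver k⦄ (hY : IsSmoothProjective m Y) (f : X ⟶ Y) (i : ℕ),
    ∃ φ : HodgeStructure.Hom (hodge hY i) (hodge hX i), φ.toLinearMap = W.pullback f i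

  polarizable : ∀ ⦃n : ℕ⦄ ⦃X : SchemeOver k⦄ (hX : IsSmoothProjective n X) (i : ℕ),
    (hodge hX i).IsPolarizable

  cycleClass_mem_hodgeClasses : ∀ ⦃n : ℕ⦄ ⦃X : SchemeOver k⦄ (hX : IsSmoothProjective n X)
    (p : ℕ) (z : X.left), Order.coheight z = p →
      W.cycleClass X p z ∈ (hodge hX (2 * p)).hodgeClasses p

namespace BettiHodgeData

variable (B : BettiHodgeData k) {n : ℕ} {X : SchemeOver k}

def isoObj (X : SchemeOver k) (i : ℕ) : B.W.obj X i ≃ₗ[ℚ] bettiCohomology X i :=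
  ((B.iso i).app (op X)).toLinearEquiv

@[simp]
lemma isoObj_apply (X : SchemeOver k) (i : ℕ) (a : B.W.obj X i) :
    B.isoObj X i a = ((B.iso i).hom.app (op X)).hom a := rfl

lemma isoObj_pullback {Y : SchemeOver k} (f : X ⟶ Y) (i : ℕ) (a : B.W.obj Y i) :
    B.isoObj X i (B.W.pullback f i a) = bettiCohomology.map f i (B.isoObj Y i a) := by
  have h := congrArg (fun g ↦ g.hom a) ((B.iso i).hom.naturality f.op)
  simp only [ModuleCat.hom_comp, LinearMap.comp_apply] at h
  exact h

theorem algebraicClasses_le_hodgeClasses (hX : IsSmoothProjective n X) (p : ℕ) :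
    B.W.algebraicClasses X p ≤ (B.hodge hX (2 * p)).hodgeClasses p := by
  refine Submodule.span_le.2 ?_
  change B.W.algebraicLattice X p ≤ ((B.hodge hX (2 * p)).hodgeClasses p).toAddSubgroup
  refine (AddSubgroup.closure_le _).2 ?_
  rintro _ ⟨z, rfl⟩
  exact B.cycleClass_mem_hodgeClasses hX p z z.2

def HodgeConjectureFor (hX : IsSmoothProjective n X) (p : ℕ) : Prop :=
  B.W.algebraicClasses X p = (B.hodge hX (2 * p)).hodgeClasses p

theorem hodgeConjectureFor_iff (hX : IsSmoothProjective n X) (p : ℕ) :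
    B.HodgeConjectureFor hX p ↔
      (B.hodge hX (2 * p)).hodgeClasses p ≤ B.W.algebraicClasses X p :=
  ⟨fun h ↦ h.ge, fun h ↦ le_antisymm (B.algebraicClasses_le_hodgeClasses hX p) h⟩

def GeneralizedHodgeConjectureFor (hX : IsSmoothProjective n X) (i r : ℕ) : Prop :=
  ∀ S : HodgeStructure.SubHodgeStructure (B.hodge hX i), S.level + 2 * r ≤ i →
    S.toSubmodule.map ((B.iso i).hom.app (op X)).hom ≤ coniveau X i r

end BettiHodgeData

end HostAPI.Carriers.AlgebraicGeometry.Motives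

end
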